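import Literature.Geometry.Lorentzian.KerrRedShiftEstimate
import Literature.Geometry.Lorentzian.KerrHorizonRegularWaveBoundednessReduction
import Literature.Geometry.Lorentzian.KerrFarEnergyComparison
import HarnessLib

/-!
# The far-region energy estimate of the Killing field `χT` between admissible graph leaves
# (Dafermos–Rodnianski–Shlapentokh-Rothman, §13.2, second display)

(family `gr`; namespaces `Literature.Geometry.Lorentzian.Kerr` and `Literature.Geometry.Lorentzian`;
written from the proving seat of the named fact
`DafermosRodnianskiShlapentokhRothman2016_energyBoundedness_horizonRegular`
(`KerrHorizonRegularWaveBoundedness.lean`); no named facts are introduced (D-0026).)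

DRSR arXiv:1402.7034, §13.2: "we may consider the energy estimate associated to `χ_{A₁−δ}T` where
`χ_{A₁−δ}` is a cutoff which is identically `1` on `[A₁−δ, ∞)` and identically `0` on
`[r₊, A₁−2δ]`. We obtain
`∫_{Σ_τ ∩ [A₁−δ,∞)} J^T_μ[ψ] n^μ ≤ ∫_{Σ_0} J^N_μ[ψ]n^μ + B∫_0^τ∫_{Σ_s ∩ [A₁−2δ, A₁−δ]} J^N_μ[ψ]n^μ`."
Here this is proved in the ingoing Kerr–Schild chart for radii `2M < R₁ < R₂` (so that `T = ∂_{t*}`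
is uniformly timelike on `{r ≥ R₁}`: `2H ≤ 2M/R₁ < 1`), between the graph leaves
`Σ̃_u = {x⁰ = u + F(x⃗)}` of a `C²` height of slope `‖dF‖ ≤ 1 − c`, for solutions `Φ` of class `C²`
on the exterior whose data vanish far out on `Σ̃_0` (so that, by the domain of dependence
`Kerr.vanish_of_graphData_far`, `dΦ` vanishes far out on the slab between `Σ̃_0` and `Σ̃_s`):

* `Kerr.far_killingEnergy_estimate` —
  `∫_{Σ̃_s ∩ {r ≥ R₂}} ∑(∂Φ)² dy ≤ (C/c)(∫_{Σ̃_0 ∩ {r ≥ R₁}} ∑(∂Φ)² dy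
      + ∫_0^s ∫_{Σ̃_u ∩ {R₁ ≤ r ≤ R₂}} ∑(∂Φ)² dy du)` in `[0, ∞]`, `C = C(M, a, R₁, R₂)`;
* `kerr_horizonRegular_far_killingEnergy_estimate` — the same for the class of the named fact
  (smooth `ψ : Kerr.region a r₀ → ℝ` solving `□_g ψ = 0` on `{r > r₊}` with compactly supported
  data on `{t* = F}`, `F` admissible), with `graphSliceEnergyOn`.

Proof: the energy inequality along the graph foliation
`E4.graphFlux_add_integral_le_of_divergence_le` (`KerrRedShiftEstimate.lean`) for the current
`(1 − χ) ζ (−J^T)[Φ]`, `χ = Kerr.collarCutoff a R₁ R₂`, `ζ` a spatial cut-off equal to `1` on the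
support of `dΦ` in the slab: `∑ ∂_μ (J^T)^μ = 0` for solutions (`Kerr.sum_fderiv_tCurrent`,
stationarity), the leaf flux `−J^T_μ n_μ` is comparable to `∑(∂Φ)²` on `{r ≥ R₁}`
(`Kerr.graphFluxDensity_bounds_of_le`: `2H ≤ 1 − c_H`, `‖dF‖ ≤ 1 − c`), and the cut-off error
`ζ dχ·J^T` is bounded by `C (∑|∂χ|) ∑(∂Φ)²`, supported in the shell `{R₁ ≤ r ≤ R₂}`.

## References

* M. Dafermos, I. Rodnianski, Y. Shlapentokh-Rothman, Ann. of Math. 183 (2016), arXiv:1402.7034,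
  §2.2.2, §2.3.2, §13.2 (key `DafermosRodnianskiShlapentokhrothman2014`).
* S. W. Hawking, G. F. R. Ellis, *The large scale structure of space-time*, CUP 1973, §4.3
  (key `HawkingEllis1973CUP`).
-/

noncomputable section

open Set Filter Metric MeasureTheory
open scoped Topology Manifold ContDiff ENNReal

namespace Literature.Geometry.Lorentzian

namespace Kerr

variable {M a : ℝ} {x : E4}

/-- `2H ≤ 2M/R₁` at points with `r ≥ R₁ > 0` (`H ≤ M/r`, `Kerr.scalarH_le_div`). [folklore] -/
theorem two_mul_scalarH_le_of_le_radius {M : ℝ} (hM : 0 ≤ M) (a : ℝ) {R₁ : ℝ} (hR₁ : 0 < R₁)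
    (hx : R₁ ≤ radius a x) : 2 * scalarH M a x ≤ 2 * M / R₁ := by
  have hr : 0 < radius a x := hR₁.trans_le hx
  have h1 := scalarH_le_div hM a hr
  have h2 : M / radius a x ≤ M / R₁ := div_le_div_of_nonneg_left hM hR₁ hx
  rw [mul_div_assoc]
  linarith

/-- **The components of the `∂_{t*}`-current are bounded by the coordinate energy density** at
points with `r ≥ r₊`: `|(J^T)^μ[Φ]| ≤ 6 (1 + Φ_B) ∑_κ (∂_κΦ)²`, `Φ_B` the profile bound of the
surgered background `Kerr.surgeryBackground M a r₊` (whose inverse metric is `g_{M,a}⁻¹` there;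
`KerrSchild.Background.abs_multiplierCurrent_le` with `X = ∂_0`). [folklore] -/
theorem abs_tCurrent_le (hMa : IsSubextremal M a) (Φ : E4 → ℝ) (hx : rPlus M a ≤ radius a x)
    (μ : Fin 4) :
    |tCurrent M a Φ x μ| ≤
      6 * (1 + (surgeryBackground M a (rPlus M a) hMa.pos.le hMa.rPlus_pos).bound) *
        ∑ κ, fderiv ℝ Φ x (E4.basisVector κ) ^ 2 := by
  set B := surgeryBackground M a (rPlus M a) hMa.pos.le hMa.rPlus_pos with hB
  have hG : inverseMetric M a x = B.inverseMetric x :=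
    (surgeryBackground_inverseMetric_eq hMa.pos.le a hMa.rPlus_pos hx).symm
  have h1 : tCurrent M a Φ x μ = KerrSchild.multiplierCurrent B.inverseMetric
      (fun _ ν ↦ if ν = 0 then (1 : ℝ) else 0) Φ x μ := by
    rw [tCurrent_eq_multiplierCurrent]
    simp only [KerrSchild.multiplierCurrent, hG]
  rw [h1]
  have h2 := B.abs_multiplierCurrent_le Φ x (X := fun _ ν ↦ if ν = 0 then (1 : ℝ) else 0)
    (Ξ := 1) (fun α ↦ by
      show |(if α = 0 then (1 : ℝ) else 0)| ≤ 1
      split_ifs <;> simp) μ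
  simpa only [mul_one] using h2
set_option maxHeartbeats 400000 in -- buildfix (bf3-g26): 160k/180k FAIL, 200k PASS at accept time; line-neutral budget line
/-- **The far-region energy estimate of `χT` between graph leaves** (DRSR arXiv:1402.7034, §13.2,
second display, first inequality, in the ingoing Kerr–Schild chart). For subextremal `(M, a)` and
radii `2M < R₁ < R₂` there is `C > 0` such that for every `C²` height `F` of slope `‖dF‖ ≤ 1 − c`
(`0 < c ≤ 1`), every `Φ : ℝ⁴ → ℝ` of class `C²` on the exterior solving the Kerr wave equation
there whose data `(Φ, dΦ)` vanish at the exterior points of `Σ̃_0 = {x⁰ = F(x⃗)}` with `‖x⃗‖ > ρ`,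
and every `s ≥ 0`,
`∫_{Σ̃_s ∩ {r ≥ R₂}} ∑(∂Φ)² dy
  ≤ (C/c) (∫_{Σ̃_0 ∩ {r ≥ R₁}} ∑(∂Φ)² dy + ∫_0^s ∫_{Σ̃_u ∩ {R₁ ≤ r ≤ R₂}} ∑(∂Φ)² dy du)`
in `[0, ∞]` (`Σ̃_u = {x⁰ = u + F(x⃗)}`). The energy identity of `(1 − χ)T`, `χ` the collar cut-off,
has no bulk where `χ` is constant (`T` is Killing) and a signed, coercive flux through the leaves
where `T` is timelike (`r ≥ R₁ > 2M ≥ r₊`); the cut-off error lives in the shell.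
[cite: DafermosRodnianskiShlapentokhrothman2014, §13.2] -/
theorem far_killingEnergy_estimate (hMa : IsSubextremal M a) {R₁ R₂ : ℝ} (hR₁ : 2 * M < R₁)
    (hR : R₁ < R₂) :
    ∃ C : ℝ, 0 < C ∧ ∀ (F : E3 → ℝ) (c : ℝ), ContDiff ℝ 2 F → 0 < c → c ≤ 1 →
      (∀ y, ‖fderiv ℝ F y‖ ≤ 1 - c) →
      ∀ Φ : E4 → ℝ, (∀ x ∈ (exterior M a : Set E4), ContDiffAt ℝ 2 Φ x) →
      (∀ x ∈ (exterior M a : Set E4),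
        KerrSchild.waveOperator
          (KerrSchild.inverseMetric (fun y ↦ 2 * scalarH M a y) (nullVector a)) Φ x = 0) →
      ∀ ρ : ℝ, (∀ y : E3, ρ < ‖y‖ → E4.ofTimeSpace (0 + F y) y ∈ exterior M a →
          Φ (E4.ofTimeSpace (0 + F y) y) = 0 ∧ fderiv ℝ Φ (E4.ofTimeSpace (0 + F y) y) = 0) →
      ∀ s : ℝ, 0 ≤ s →
        ∫⁻ y, {y : E3 | R₂ ≤ radius a (E4.ofTimeSpace (s + F y) y)}.indicator
            (fun y ↦ ENNReal.ofReal
              (∑ μ, fderiv ℝ Φ (E4.ofTimeSpace (s + F y) y) (E4.basisVector μ) ^ 2)) y ≤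
        ENNReal.ofReal (C / c) *
          ((∫⁻ y, {y : E3 | R₁ ≤ radius a (E4.ofTimeSpace (0 + F y) y)}.indicator
              (fun y ↦ ENNReal.ofReal
                (∑ μ, fderiv ℝ Φ (E4.ofTimeSpace (0 + F y) y) (E4.basisVector μ) ^ 2)) y) +
            ∫⁻ u in Set.Ioc 0 s, ∫⁻ y,
              {y : E3 | R₁ ≤ radius a (E4.ofTimeSpace (u + F y) y) ∧
                radius a (E4.ofTimeSpace (u + F y) y) ≤ R₂}.indicator
              (fun y ↦ ENNReal.ofReal
                (∑ μ, fderiv ℝ Φ (E4.ofTimeSpace (u + F y) y) (E4.basisVector μ) ^ 2)) y) := by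
  -- ### constants
  have hM : 0 < M := hMa.pos
  have hrp : 0 < rPlus M a := hMa.rPlus_pos
  have hR₁r : rPlus M a < R₁ := (rPlus_le_two_mul hM.le).trans_lt hR₁
  have hR₁pos : 0 < R₁ := hrp.trans hR₁r
  set B := surgeryBackground M a (rPlus M a) hMa.pos.le hMa.rPlus_pos with hB
  have hΦb0 : 0 ≤ B.bound := (B.φ_nonneg 0).trans (B.φ_le 0)
  set cH : ℝ := 1 - 2 * M / R₁ with hcH
  have hcH0 : 0 < cH := by
    have : 2 * M / R₁ < 1 := (div_lt_one hR₁pos).mpr hR₁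
    rw [hcH]; linarith
  have hcH1 : cH ≤ 1 := by
    have : 0 ≤ 2 * M / R₁ := by positivity
    rw [hcH]; linarith
  obtain ⟨L, hL0, hL⟩ := exists_abs_fderiv_collarCutoff_le (a := a) hR₁pos hR
  set CT : ℝ := 6 * (1 + B.bound) with hCT
  have hCT0 : 0 ≤ CT := by positivity
  set C : ℝ := 6 / cH * (7 / 2 + CT * (4 * L) + 1) with hCdef
  have hCpos : 0 < C := by positivity
  refine ⟨C, hCpos, fun F c hF hc hc1 hslope Φ hΦ hsol ρ hdata s hs ↦ ?_⟩
  -- ### vanishing of `dΦ` far out on the slab (domain of dependence)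
  set ρ₀ : ℝ := (2 * max ρ 0 + 1 + s) / c with hρ₀
  have hρ₀pos : 0 < ρ₀ := by positivity
  have hvan : ∀ (u : ℝ) (y : E3), 0 ≤ u → u ≤ s → ρ₀ < ‖y‖ →
      E4.ofTimeSpace (u + F y) y ∈ exterior M a → fderiv ℝ Φ (E4.ofTimeSpace (u + F y) y) = 0 := by
    intro u y hu hus hy hext
    have hF₂ : ContDiff ℝ 2 (fun y ↦ u + F y) := contDiff_const.add hF
    have hs₂ : ∀ y, ‖fderiv ℝ (fun y ↦ u + F y) y‖ ≤ 1 - c := fun y ↦ by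
      rw [fderiv_const_add]; exact hslope y
    have hle : ∀ y, F y ≤ u + F y := fun y ↦ by linarith
    have hLu : ∀ y, (u + F y) - F y ≤ u := fun y ↦ by linarith
    have hy' : (2 * max ρ 0 + 1 + ((u + F 0) - F 0)) / c < ‖y‖ := by
      refine lt_of_le_of_lt ?_ hy
      rw [hρ₀]
      gcongr
      linarith
    have hext' : E4.ofTimeSpace (0 + (u + F y)) y ∈ exterior M a := by rwa [zero_add]
    have h := (vanish_of_graphData_far hMa hF hF₂ hc hc1 hslope hs₂ hle hLu hΦ hsol hdata hy'
      hext').2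
    rwa [zero_add] at h
  have hvanx : ∀ x ∈ (exterior M a : Set E4), F (E4.spatial x) ≤ x 0 →
      x 0 ≤ s + F (E4.spatial x) → ρ₀ < E4.spatialNorm x → fderiv ℝ Φ x = 0 := by
    intro x hx h1 h2 h3
    have hxeq : E4.ofTimeSpace ((x 0 - F (E4.spatial x)) + F (E4.spatial x)) (E4.spatial x) = x := by
      rw [sub_add_cancel, ← E4.time_apply]
      exact E4.ofTimeSpace_time_spatial x
    have h := hvan (x 0 - F (E4.spatial x)) (E4.spatial x) (by linarith) (by linarith) h3
      (by rw [hxeq]; exact hx)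
    rwa [hxeq] at h
  -- ### notation: cut-offs, weight, support set, currents
  set ρ' : ℝ := ρ₀ + 1 with hρ'
  have hρ'pos : 0 < ρ' := by positivity
  set χ : E4 → ℝ := collarCutoff a R₁ R₂ with hχ
  set W : E4 → ℝ := fun x ↦ 1 - χ x with hW
  set ζ : E4 → ℝ := fun x ↦ 1 - radialTransition ρ' ρ' (E4.spatial x) with hζ
  set w : E4 → ℝ := fun x ↦ W x * ζ x with hw
  set K : Set E4 := {x | R₁ ≤ radius a x ∧ E4.spatialNorm x ≤ 2 * ρ'} with hK
  set U : Set E4 := (exterior M a : Set E4) with hU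
  set p2 : E4 → ℝ := fun x ↦ ∑ μ, fderiv ℝ Φ x (E4.basisVector μ) ^ 2 with hp2
  set V : E4 → ℝ := fun x ↦ ∑ μ, |fderiv ℝ χ x (E4.basisVector μ)| with hV
  set Tn : Fin 4 → E4 → ℝ := fun μ x ↦ -tCurrent M a Φ x μ with hTn
  set J : Fin 4 → E4 → ℝ := fun μ x ↦ w x * Tn μ x with hJ
  set e : E4 → ℝ := fun x ↦ CT * (V x * p2 x) with he
  set ℓ : E4 → ℝ := fun _ ↦ 0 with hℓ
  have hp2nn : ∀ x, 0 ≤ p2 x := fun x ↦ Finset.sum_nonneg fun μ _ ↦ sq_nonneg _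
  have hV0 : ∀ x, 0 ≤ V x := fun x ↦ Finset.sum_nonneg fun μ _ ↦ abs_nonneg _
  have hVle : ∀ x, V x ≤ 4 * L := fun x ↦ by
    calc V x = ∑ μ, |fderiv ℝ χ x (E4.basisVector μ)| := rfl
      _ ≤ ∑ _μ : Fin 4, L := Finset.sum_le_sum fun μ _ ↦ (hL x μ).1
      _ = 4 * L := by
          simp only [Finset.sum_const, Finset.card_univ, Fintype.card_fin, nsmul_eq_mul,
            Nat.cast_ofNat]
  -- the cut-offs
  have hχ1 : ContDiff ℝ 1 χ := contDiff_collarCutoff hR₁pos hR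
  have hχ0 : ∀ x, 0 ≤ χ x := collarCutoff_nonneg a R₁ R₂
  have hχle : ∀ x, χ x ≤ 1 := collarCutoff_le_one a R₁ R₂
  have hW1 : ContDiff ℝ 1 W := contDiff_const.sub hχ1
  have hW0 : ∀ x, 0 ≤ W x := fun x ↦ by simp only [hW]; linarith [hχle x]
  have hWle : ∀ x, W x ≤ 1 := fun x ↦ by simp only [hW]; linarith [hχ0 x]
  have hWz : ∀ x, radius a x ≤ R₁ → W x = 0 := fun x hx ↦ by
    simp only [hW, hχ, collarCutoff_eq_one hR hx, sub_self]
  have hWone : ∀ x, R₂ ≤ radius a x → W x = 1 := fun x hx ↦ by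
    simp only [hW, hχ, collarCutoff_eq_zero hR hx, sub_zero]
  have hζ1 : ContDiff ℝ 1 ζ :=
    contDiff_const.sub ((contDiff_radialTransition hρ'pos hρ'pos).comp E4.spatial.contDiff)
  have hζ0 : ∀ x, 0 ≤ ζ x := fun x ↦ by
    simp only [hζ]; linarith [radialTransition_le_one ρ' ρ' (E4.spatial x)]
  have hζle : ∀ x, ζ x ≤ 1 := fun x ↦ by
    simp only [hζ]; linarith [radialTransition_nonneg ρ' ρ' (E4.spatial x)]
  have hζone : ∀ x, E4.spatialNorm x ≤ ρ' → ζ x = 1 := fun x hx ↦ by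
    simp only [hζ, radialTransition_of_norm_le hρ'pos (show ‖E4.spatial x‖ ≤ ρ' from hx), sub_zero]
  have hζz : ∀ x, 2 * ρ' ≤ E4.spatialNorm x → ζ x = 0 := fun x hx ↦ by
    have h : ρ' + ρ' ≤ ‖E4.spatial x‖ := by
      show ρ' + ρ' ≤ E4.spatialNorm x
      linarith
    simp only [hζ, radialTransition_of_le_norm hρ'pos h, sub_self]
  have hζd0 : ∀ x, E4.spatialNorm x < ρ' → fderiv ℝ ζ x = 0 := by
    intro x hx
    have hcont : Continuous fun z : E4 ↦ E4.spatialNorm z :=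
      continuous_norm.comp E4.spatial.continuous
    have hev : ζ =ᶠ[𝓝 x] fun _ ↦ (1 : ℝ) := by
      filter_upwards [(isOpen_lt hcont continuous_const).mem_nhds hx] with z hz
      exact hζone z (le_of_lt hz)
    rw [hev.fderiv_eq]
    simp
  have hw1 : ContDiff ℝ 1 w := hW1.mul hζ1
  have hw0 : ∀ x, 0 ≤ w x := fun x ↦ mul_nonneg (hW0 x) (hζ0 x)
  have hwle : ∀ x, w x ≤ 1 := fun x ↦ mul_le_one₀ (hWle x) (hζ0 x) (hζle x)
  -- the support set
  have hKc : IsClosed K := by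
    rw [hK, Set.setOf_and]
    exact (isClosed_le continuous_const (continuous_radius a)).inter
      (isClosed_le (continuous_norm.comp E4.spatial.continuous) continuous_const)
  have hKU : K ⊆ U := fun x hx ↦
    mem_exterior.2 (max_lt (hR₁r.trans_le hx.1) (hrp.trans (hR₁r.trans_le hx.1)))
  have hwK : ∀ x, w x ≠ 0 → x ∈ K := by
    intro x hx
    refine ⟨?_, ?_⟩
    · by_contra h
      exact left_ne_zero_of_mul hx (hWz x (not_le.mp h).le)
    · by_contra h
      exact right_ne_zero_of_mul hx (hζz x (not_le.mp h).le)
  have hwz : ∀ x, x ∉ K → w x = 0 := fun x hx ↦ by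
    by_contra h
    exact hx (hwK x h)
  have hKr : ∀ x ∈ K, rPlus M a < radius a x := fun x hx ↦ hR₁r.trans_le hx.1
  have hUpos : ∀ x ∈ U, 0 < radius a x := fun x hx ↦ radius_pos_of_mem_region hx
  -- ### regularity of the current
  have hTn1 : ∀ μ, ∀ x ∈ U, ContDiffAt ℝ 1 (Tn μ) x := by
    intro μ x hx
    have h2 : ContDiffAt ℝ ((1 : ℕ∞) + 1 : ℕ∞) Φ x := by exact_mod_cast hΦ x hx
    exact (contDiffAt_tCurrent M a h2 (hUpos x hx) μ).neg
  have hJ1 : ∀ μ, ContDiff ℝ 1 (J μ) := fun μ ↦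
    contDiff_iff_contDiffAt.mpr fun x ↦ contDiffAt_weight_mul hKc hKU hw1 hwK (hTn1 μ) x
  have hJ0 : ∀ μ x, x ∉ K → J μ x = 0 := fun μ x hx ↦ by
    simp only [hJ, hwz x hx, zero_mul]
  -- continuity of `e` on `ℝ⁴`
  have hp2c : ∀ x ∈ U, ContinuousAt p2 x := by
    intro x hx
    have h2 : ContDiffAt ℝ ((1 : ℕ∞) + 1 : ℕ∞) Φ x := by exact_mod_cast hΦ x hx
    exact tendsto_finsetSum _ fun ν _ ↦
      (((h2.fderiv_right (m := 1) le_rfl).clm_apply contDiffAt_const).continuousAt).pow 2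
  set Ksh : Set E4 := {x | R₁ ≤ radius a x ∧ radius a x ≤ R₂} with hKsh
  have hKshc : IsClosed Ksh := by
    rw [hKsh, Set.setOf_and]
    exact (isClosed_le continuous_const (continuous_radius a)).inter
      (isClosed_le (continuous_radius a) continuous_const)
  have hKshU : Ksh ⊆ U := fun x hx ↦
    mem_exterior.2 (max_lt (hR₁r.trans_le hx.1) (hrp.trans (hR₁r.trans_le hx.1)))
  have hVc : Continuous V :=
    continuous_finsetSum _ fun μ _ ↦
      ((hχ1.continuous_fderiv one_ne_zero).clm_apply continuous_const).abs
  have hVz : ∀ x, x ∉ Ksh → V x = 0 := by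
    intro x hx
    refine Finset.sum_eq_zero fun μ _ ↦ ?_
    by_contra hne
    exact hx ((hL x μ).2 (fun h0 ↦ hne (by rw [h0, abs_zero])))
  have hVp2c : Continuous fun x ↦ V x * p2 x :=
    continuous_iff_continuousAt.mpr fun x ↦ continuousAt_weight_mul hKshc hKshU hVc hVz hp2c x
  have hec : Continuous e := continuous_const.mul hVp2c
  have he0 : ∀ x, 0 ≤ e x := fun x ↦ mul_nonneg hCT0 (mul_nonneg (hV0 x) (hp2nn x))
  have hℓc : Continuous ℓ := continuous_const
  have hℓK : ∀ x, x ∉ K → ℓ x = 0 := fun _ _ ↦ rfl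
  have hρK : ∀ x ∈ K, F (E4.spatial x) ≤ x 0 → x 0 ≤ s + F (E4.spatial x) →
      E4.spatialNorm x ≤ 2 * ρ' := fun x hx _ _ ↦ hx.2
  -- ### pointwise bounds on the current at points with `r ≥ r₊`
  have hTnle : ∀ x ∈ K, ∀ μ, |Tn μ x| ≤ CT * p2 x := fun x hx μ ↦ by
    simp only [hTn, abs_neg]
    exact abs_tCurrent_le hMa Φ (hKr x hx).le μ
  -- ### the divergence of the current at the points of `K` in the slab
  have hdiv : ∀ x ∈ K, F (E4.spatial x) ≤ x 0 → x 0 ≤ s + F (E4.spatial x) →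
      ∑ μ, fderiv ℝ (J μ) x (E4.basisVector μ) ≤ -ℓ x + e x := by
    intro x hxK hx1 hx2
    have hxU : x ∈ U := hKU hxK
    have hxpos : 0 < radius a x := hUpos x hxU
    show ∑ μ, fderiv ℝ (J μ) x (E4.basisVector μ) ≤ -0 + e x
    rw [neg_zero, zero_add]
    -- differentiability and the product rule
    have hwd : DifferentiableAt ℝ w x := (hw1.differentiable one_ne_zero) x
    have hWd : DifferentiableAt ℝ W x := (hW1.differentiable one_ne_zero) x
    have hζd : DifferentiableAt ℝ ζ x := (hζ1.differentiable one_ne_zero) x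
    have hχd : DifferentiableAt ℝ χ x := (hχ1.differentiable one_ne_zero) x
    have hTnd : ∀ μ, DifferentiableAt ℝ (Tn μ) x := fun μ ↦
      (hTn1 μ x hxU).differentiableAt one_ne_zero
    have hdJ : ∀ μ κ, fderiv ℝ (J μ) x (E4.basisVector κ) =
        fderiv ℝ w x (E4.basisVector κ) * Tn μ x + w x * fderiv ℝ (Tn μ) x (E4.basisVector κ) := by
      intro μ κ
      have : J μ = fun y ↦ w y * Tn μ y := rfl
      rw [this, fderiv_fun_mul hwd (hTnd μ)]
      simp only [add_apply, FunLike.coe_smul, Pi.smul_apply, smul_eq_mul]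
      ring
    have hdw : ∀ κ, fderiv ℝ w x (E4.basisVector κ) =
        -fderiv ℝ χ x (E4.basisVector κ) * ζ x + W x * fderiv ℝ ζ x (E4.basisVector κ) := by
      intro κ
      have h1 : w = fun y ↦ W y * ζ y := rfl
      have h2 : W = fun y ↦ 1 - χ y := rfl
      rw [h1, fderiv_fun_mul hWd hζd, h2, fderiv_fun_sub (differentiableAt_const _) hχd,
        fderiv_fun_const]
      simp only [add_apply, sub_apply, FunLike.coe_smul, Pi.smul_apply, smul_eq_mul,
        Pi.zero_apply, zero_apply]
      ring
    -- the current of `T` is divergence free for solutions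
    have hdivT : ∑ μ, fderiv ℝ (Tn μ) x (E4.basisVector μ) = 0 := by
      have h0 : ∑ μ, fderiv ℝ (fun y ↦ tCurrent M a Φ y μ) x (E4.basisVector μ) = 0 := by
        rw [sum_fderiv_tCurrent M a hxpos (hΦ x hxU)]
        have h1 : (∑ μ, fderiv ℝ (fun y ↦ ∑ ν, inverseMetric M a y μ ν *
            fderiv ℝ Φ y (E4.basisVector ν)) x (E4.basisVector μ)) =
            KerrSchild.waveOperator
              (KerrSchild.inverseMetric (fun y ↦ 2 * scalarH M a y) (nullVector a)) Φ x := by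
          simp only [KerrSchild.waveOperator, inverseMetric_eq_kerrSchild]
        rw [h1, hsol x hxU, zero_mul]
      have h1 : ∀ μ, fderiv ℝ (Tn μ) x (E4.basisVector μ) =
          -fderiv ℝ (fun y ↦ tCurrent M a Φ y μ) x (E4.basisVector μ) := by
        intro μ
        have : Tn μ = fun y ↦ -tCurrent M a Φ y μ := rfl
        rw [this, fderiv_fun_neg, neg_apply]
      simp only [h1, Finset.sum_neg_distrib, h0, neg_zero]
    by_cases hd : fderiv ℝ Φ x = 0
    · -- `dΦ(x) = 0`: the current and its derivative vanish at `x`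
      have hT0 : ∀ μ, Tn μ x = 0 := fun μ ↦ by
        simp only [hTn, tCurrent_eq_zero_of_fderiv_eq_zero M a hd μ, neg_zero]
      have hdT0 : ∀ μ, fderiv ℝ (Tn μ) x = 0 := fun μ ↦ by
        have h := fderiv_tCurrent_eq_zero_of_fderiv_eq_zero M a (hΦ x hxU) hxpos hd μ
        have : Tn μ = fun y ↦ -tCurrent M a Φ y μ := rfl
        rw [this, fderiv_fun_neg, h, neg_zero]
      have hz : ∑ μ, fderiv ℝ (J μ) x (E4.basisVector μ) = 0 :=
        Finset.sum_eq_zero fun μ _ ↦ by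
          rw [hdJ μ μ, hT0 μ, hdT0 μ, zero_apply, mul_zero, mul_zero, add_zero]
      rw [hz]
      exact he0 x
    · -- `dΦ(x) ≠ 0`: then `‖x⃗‖ ≤ ρ₀`, where `ζ = 1` to first order
      have hxn : E4.spatialNorm x ≤ ρ₀ := by
        by_contra h
        exact hd (hvanx x hxU hx1 hx2 (not_le.mp h))
      have hζx : fderiv ℝ ζ x = 0 := hζd0 x (by rw [hρ']; linarith)
      have hterm : ∀ μ, fderiv ℝ (J μ) x (E4.basisVector μ) =
          ζ x * (-fderiv ℝ χ x (E4.basisVector μ) * Tn μ x) +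
            w x * fderiv ℝ (Tn μ) x (E4.basisVector μ) := by
        intro μ
        rw [hdJ μ μ, hdw μ, hζx, zero_apply, mul_zero, add_zero]
        ring
      have hsum : ∑ μ, fderiv ℝ (J μ) x (E4.basisVector μ) =
          ζ x * ∑ μ, -fderiv ℝ χ x (E4.basisVector μ) * Tn μ x := by
        rw [Finset.sum_congr rfl fun μ _ ↦ hterm μ, Finset.sum_add_distrib, ← Finset.mul_sum,
          ← Finset.mul_sum, hdivT, mul_zero, add_zero]
      rw [hsum]
      have h1 : |∑ μ, -fderiv ℝ χ x (E4.basisVector μ) * Tn μ x| ≤ CT * (V x * p2 x) := by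
        calc |∑ μ, -fderiv ℝ χ x (E4.basisVector μ) * Tn μ x|
            ≤ ∑ μ, |-fderiv ℝ χ x (E4.basisVector μ) * Tn μ x| := Finset.abs_sum_le_sum_abs _ _
          _ ≤ ∑ μ, |fderiv ℝ χ x (E4.basisVector μ)| * (CT * p2 x) := by
              refine Finset.sum_le_sum fun μ _ ↦ ?_
              rw [abs_mul, abs_neg]
              exact mul_le_mul_of_nonneg_left (hTnle x hxK μ) (abs_nonneg _)
          _ = CT * (V x * p2 x) := by rw [hV, ← Finset.sum_mul]; ring
      calc ζ x * ∑ μ, -fderiv ℝ χ x (E4.basisVector μ) * Tn μ x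
          ≤ ζ x * |∑ μ, -fderiv ℝ χ x (E4.basisVector μ) * Tn μ x| :=
            mul_le_mul_of_nonneg_left (le_abs_self _) (hζ0 x)
        _ ≤ 1 * |∑ μ, -fderiv ℝ χ x (E4.basisVector μ) * Tn μ x| :=
            mul_le_mul_of_nonneg_right (hζle x) (abs_nonneg _)
        _ ≤ e x := by rw [one_mul]; exact h1
  -- ### the energy inequality along the graph foliation
  have hmain := E4.graphFlux_add_integral_le_of_divergence_le hKc hJ1 hJ0 hF hρK hℓc hec hℓK he0
    hdiv hs le_rfl
  -- ### the leaf flux density `q = w · f`, `f = −J^T_μ n_μ` the graph flux density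
  set q : ℝ → E3 → ℝ := fun t y ↦
    ∑ μ, J μ (E4.ofTimeSpace (t + F y) y) * graphConormal F y μ with hq
  have hqf : ∀ t y, q t y = w (E4.ofTimeSpace (t + F y) y) * graphFluxDensity M a F Φ t y := by
    intro t y
    simp only [hq, hJ, hTn, graphFluxDensity, Finset.mul_sum, ← Finset.sum_neg_distrib]
    exact Finset.sum_congr rfl fun μ _ ↦ by ring
  have hccH : c * cH ≤ min c cH := by
    rcases le_total c cH with h | h
    · rw [min_eq_left h]; nlinarith
    · rw [min_eq_right h]; nlinarith
  have hfbd : ∀ t y, R₁ ≤ radius a (E4.ofTimeSpace (t + F y) y) →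
      c * cH / 6 * p2 (E4.ofTimeSpace (t + F y) y) ≤ graphFluxDensity M a F Φ t y ∧
        graphFluxDensity M a F Φ t y ≤ 7 / 2 * p2 (E4.ofTimeSpace (t + F y) y) := by
    intro t y hr
    have hpos : 0 < radius a (E4.ofTimeSpace (t + F y) y) := hR₁pos.trans_le hr
    have hH : 2 * scalarH M a (E4.ofTimeSpace (t + F y) y) ≤ 1 - min c cH :=
      (two_mul_scalarH_le_of_le_radius hM.le a hR₁pos hr).trans
        (by rw [hcH]; linarith [min_le_right c cH])
    have hF' : ‖fderiv ℝ F y‖ ≤ 1 - min c cH := (hslope y).trans (by linarith [min_le_left c cH])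
    obtain ⟨h1, h2⟩ := graphFluxDensity_bounds_of_le hM.le a F Φ t y (lt_min hc hcH0) hpos hH hF'
    refine ⟨le_trans ?_ h1, h2⟩
    exact mul_le_mul_of_nonneg_right (by linarith) (hp2nn _)
  have hqnn : ∀ t y, 0 ≤ q t y := by
    intro t y
    rw [hqf]
    by_cases hWy : W (E4.ofTimeSpace (t + F y) y) = 0
    · simp only [hw, hWy, zero_mul, le_refl]
    · have hr : R₁ ≤ radius a (E4.ofTimeSpace (t + F y) y) := by
        by_contra h
        exact hWy (hWz _ (not_le.mp h).le)
      have h := (hfbd t y hr).1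
      have : 0 ≤ c * cH / 6 * p2 (E4.ofTimeSpace (t + F y) y) :=
        mul_nonneg (by positivity) (hp2nn _)
      exact mul_nonneg (hw0 _) (by linarith)
  have hqup : ∀ y, q 0 y ≤ 7 / 2 * (w (E4.ofTimeSpace (0 + F y) y) * p2 (E4.ofTimeSpace (0 + F y) y)) := by
    intro y
    rw [hqf]
    by_cases hWy : W (E4.ofTimeSpace (0 + F y) y) = 0
    · simp only [hw, hWy, zero_mul, mul_zero, le_refl]
    · have hr : R₁ ≤ radius a (E4.ofTimeSpace (0 + F y) y) := by
        by_contra h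
        exact hWy (hWz _ (not_le.mp h).le)
      have h := (hfbd 0 y hr).2
      calc w (E4.ofTimeSpace (0 + F y) y) * graphFluxDensity M a F Φ 0 y
          ≤ w (E4.ofTimeSpace (0 + F y) y) * (7 / 2 * p2 (E4.ofTimeSpace (0 + F y) y)) :=
            mul_le_mul_of_nonneg_left h (hw0 _)
        _ = _ := by ring
  -- continuity of `q t` and integrals
  have hgraph : ∀ t : ℝ, Continuous fun y : E3 ↦ E4.ofTimeSpace (t + F y) y := fun t ↦
    E4.continuous_ofTimeSpace' (continuous_const.add hF.continuous) continuous_id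
  have hgraph2 : Continuous fun p : ℝ × E3 ↦ E4.ofTimeSpace (p.1 + F p.2) p.2 :=
    E4.continuous_ofTimeSpace' (continuous_fst.add (hF.continuous.comp continuous_snd))
      continuous_snd
  have hF1 : ContDiff ℝ 1 F := hF.of_le one_le_two
  have hnc : ∀ μ, Continuous fun y : E3 ↦ graphConormal F y μ := by
    intro μ
    refine Fin.cases ?_ (fun i ↦ ?_) μ
    · simp only [graphConormal_zero]; exact continuous_const
    · simp only [graphConormal_succ, partialE3]
      exact ((hF1.continuous_fderiv one_ne_zero).clm_apply continuous_const).neg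
  have hqc : ∀ t, Continuous (q t) := fun t ↦
    continuous_finsetSum _ fun μ _ ↦ ((hJ1 μ).continuous.comp (hgraph t)).mul (hnc μ)
  have hwp2c : Continuous fun x ↦ w x * p2 x :=
    continuous_iff_continuousAt.mpr fun x ↦ continuousAt_weight_mul hKc hKU hw1.continuous hwz hp2c x
  have hqz : ∀ t y, 2 * ρ' < ‖y‖ → q t y = 0 := by
    intro t y hy
    have hnot : E4.ofTimeSpace (t + F y) y ∉ K := fun h ↦ by
      have := h.2
      rw [E4.spatialNorm_ofTimeSpace] at this
      linarith
    simp only [hq, hJ0 _ _ hnot, zero_mul, Finset.sum_const_zero]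
  set fd : ℝ → E3 → ℝ≥0∞ := fun t y ↦
    ENNReal.ofReal (∑ μ, fderiv ℝ Φ (E4.ofTimeSpace (t + F y) y) (E4.basisVector μ) ^ 2) with hfd
  set E0 : ℝ≥0∞ := ∫⁻ y, {y : E3 | R₁ ≤ radius a (E4.ofTimeSpace (0 + F y) y)}.indicator (fd 0) y
    with hE0
  set ShI : ℝ≥0∞ := ∫⁻ u in Set.Ioc 0 s, ∫⁻ y,
    {y : E3 | R₁ ≤ radius a (E4.ofTimeSpace (u + F y) y) ∧
      radius a (E4.ofTimeSpace (u + F y) y) ≤ R₂}.indicator (fd u) y with hShI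
  show ∫⁻ y, {y : E3 | R₂ ≤ radius a (E4.ofTimeSpace (s + F y) y)}.indicator (fd s) y ≤
    ENNReal.ofReal (C / c) * (E0 + ShI)
  have hqi : ∀ t, IntegrableOn (q t) (closedBall (0 : E3) (2 * ρ')) := fun t ↦
    (hqc t).continuousOn.integrableOn_compact (isCompact_closedBall _ _)
  have hk : 0 < 6 / (c * cH) := by positivity
  -- (a) the far energy at time `s` is controlled by the flux through `Σ̃_s`
  have ha : ∫⁻ y, {y : E3 | R₂ ≤ radius a (E4.ofTimeSpace (s + F y) y)}.indicator (fd s) y ≤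
      ENNReal.ofReal (6 / (c * cH)) *
        ENNReal.ofReal (∫ y in closedBall (0 : E3) (2 * ρ'), q s y) := by
    have h1 : ∀ y, {y : E3 | R₂ ≤ radius a (E4.ofTimeSpace (s + F y) y)}.indicator (fd s) y ≤
        ENNReal.ofReal (6 / (c * cH) * q s y) := by
      intro y
      by_cases hy : y ∈ {y : E3 | R₂ ≤ radius a (E4.ofTimeSpace (s + F y) y)}
      · rw [Set.indicator_of_mem hy]
        have hyr : R₂ ≤ radius a (E4.ofTimeSpace (s + F y) y) := hy
        by_cases hd : fderiv ℝ Φ (E4.ofTimeSpace (s + F y) y) = 0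
        · have : fd s y = 0 := by
            simp only [hfd, hd, zero_apply]
            simp
          rw [this]
          exact zero_le
        · have hext : E4.ofTimeSpace (s + F y) y ∈ U :=
            mem_exterior.2 (max_lt (hR₁r.trans_le (hR.le.trans hyr))
              (hrp.trans (hR₁r.trans_le (hR.le.trans hyr))))
          have hyn : ‖y‖ ≤ ρ₀ := by
            by_contra h
            refine hd (hvanx _ hext ?_ ?_ ?_)
            · simp only [E4.spatial_ofTimeSpace, E4.ofTimeSpace_apply_zero]
              linarith
            · simp only [E4.spatial_ofTimeSpace, E4.ofTimeSpace_apply_zero]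
              linarith
            · rw [E4.spatialNorm_ofTimeSpace]
              exact not_le.mp h
          have hζy : ζ (E4.ofTimeSpace (s + F y) y) = 1 :=
            hζone _ (by rw [E4.spatialNorm_ofTimeSpace, hρ']; linarith)
          have hWy : W (E4.ofTimeSpace (s + F y) y) = 1 := hWone _ hyr
          have hwy : w (E4.ofTimeSpace (s + F y) y) = 1 := by
            simp only [hw, hWy, hζy, mul_one]
          have hlow := (hfbd s y (hR.le.trans hyr)).1
          refine ENNReal.ofReal_le_ofReal ?_
          rw [hqf, hwy, one_mul]
          have hk' : 6 / (c * cH) * (c * cH / 6 * p2 (E4.ofTimeSpace (s + F y) y)) =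
              p2 (E4.ofTimeSpace (s + F y) y) := by
            field_simp
          calc ∑ μ, fderiv ℝ Φ (E4.ofTimeSpace (s + F y) y) (E4.basisVector μ) ^ 2
              = 6 / (c * cH) * (c * cH / 6 * p2 (E4.ofTimeSpace (s + F y) y)) := hk'.symm
            _ ≤ 6 / (c * cH) * graphFluxDensity M a F Φ s y :=
                mul_le_mul_of_nonneg_left hlow hk.le
      · rw [Set.indicator_of_notMem hy]
        exact zero_le
    calc ∫⁻ y, {y : E3 | R₂ ≤ radius a (E4.ofTimeSpace (s + F y) y)}.indicator (fd s) y
        ≤ ∫⁻ y, ENNReal.ofReal (6 / (c * cH) * q s y) := lintegral_mono h1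
      _ = ∫⁻ y, (closedBall (0 : E3) (2 * ρ')).indicator
            (fun y ↦ ENNReal.ofReal (6 / (c * cH) * q s y)) y := by
          refine lintegral_congr fun y ↦ ?_
          by_cases hy : y ∈ closedBall (0 : E3) (2 * ρ')
          · rw [Set.indicator_of_mem hy]
          · rw [Set.indicator_of_notMem hy, hqz s y, mul_zero, ENNReal.ofReal_zero]
            rw [mem_closedBall, dist_zero_right, not_le] at hy
            exact hy
      _ = ∫⁻ y in closedBall (0 : E3) (2 * ρ'), ENNReal.ofReal (6 / (c * cH) * q s y) :=
          lintegral_indicator measurableSet_closedBall _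
      _ = ENNReal.ofReal (∫ y in closedBall (0 : E3) (2 * ρ'), 6 / (c * cH) * q s y) :=
          (ofReal_integral_eq_lintegral_ofReal ((hqi s).const_mul _)
            (ae_of_all _ fun y ↦ mul_nonneg hk.le (hqnn s y))).symm
      _ = ENNReal.ofReal (6 / (c * cH)) *
            ENNReal.ofReal (∫ y in closedBall (0 : E3) (2 * ρ'), q s y) := by
          rw [integral_const_mul, ENNReal.ofReal_mul hk.le]
  -- (b) the energy inequality: the flux through `Σ̃_s` is at most the flux through `Σ̃_0` plus the
  -- cut-off error
  have hflux : (∫ y in closedBall (0 : E3) (2 * ρ'), q s y) ≤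
      (∫ y in closedBall (0 : E3) (2 * ρ'), q 0 y) +
        ∫ u in Set.Ioc 0 s, ∫ y in closedBall (0 : E3) (2 * ρ'), e (E4.ofTimeSpace (u + F y) y) := by
    have h0 : (∫ u in Set.Ioc 0 s, ∫ y in closedBall (0 : E3) (2 * ρ'),
        ℓ (E4.ofTimeSpace (u + F y) y)) = 0 := by
      simp only [hℓ, integral_zero]
    have h := hmain
    rw [h0, add_zero] at h
    exact h
  -- (c) the flux through `Σ̃_0` is controlled by the initial energy on `{r ≥ R₁}`
  have hcflux : ENNReal.ofReal (∫ y in closedBall (0 : E3) (2 * ρ'), q 0 y) ≤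
      ENNReal.ofReal (7 / 2) * E0 := by
    rw [ofReal_integral_eq_lintegral_ofReal (hqi 0) (ae_of_all _ fun y ↦ hqnn 0 y), hE0,
      ← lintegral_const_mul' _ _ ENNReal.ofReal_ne_top]
    calc ∫⁻ y in closedBall (0 : E3) (2 * ρ'), ENNReal.ofReal (q 0 y)
        ≤ ∫⁻ y in closedBall (0 : E3) (2 * ρ'), ENNReal.ofReal (7 / 2) *
            {y : E3 | R₁ ≤ radius a (E4.ofTimeSpace (0 + F y) y)}.indicator (fd 0) y := by
          refine lintegral_mono fun y ↦ ?_
          by_cases hWy : w (E4.ofTimeSpace (0 + F y) y) = 0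
          · have : q 0 y = 0 := by rw [hqf, hWy, zero_mul]
            rw [this, ENNReal.ofReal_zero]
            exact zero_le
          · have hyK : E4.ofTimeSpace (0 + F y) y ∈ K := hwK _ hWy
            have hyT : y ∈ {y : E3 | R₁ ≤ radius a (E4.ofTimeSpace (0 + F y) y)} := hyK.1
            rw [Set.indicator_of_mem hyT, ← ENNReal.ofReal_mul (by norm_num)]
            refine ENNReal.ofReal_le_ofReal ((hqup y).trans ?_)
            calc 7 / 2 * (w (E4.ofTimeSpace (0 + F y) y) * p2 (E4.ofTimeSpace (0 + F y) y))
                ≤ 7 / 2 * (1 * p2 (E4.ofTimeSpace (0 + F y) y)) :=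
                  mul_le_mul_of_nonneg_left
                    (mul_le_mul_of_nonneg_right (hwle _) (hp2nn _)) (by norm_num)
              _ = 7 / 2 * p2 (E4.ofTimeSpace (0 + F y) y) := by rw [one_mul]
      _ ≤ ∫⁻ y, ENNReal.ofReal (7 / 2) *
            {y : E3 | R₁ ≤ radius a (E4.ofTimeSpace (0 + F y) y)}.indicator (fd 0) y :=
          setLIntegral_le_lintegral _ _
  -- (d) the cut-off error is controlled by the energy in the shell
  set Zt : ℝ → ℝ := fun t ↦ ∫ y in closedBall (0 : E3) (2 * ρ'),
    V (E4.ofTimeSpace (t + F y) y) * p2 (E4.ofTimeSpace (t + F y) y) with hZt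
  have hZc : Continuous Zt :=
    continuous_parametric_integral_of_continuous
      (f := fun (t : ℝ) (y : E3) ↦ V (E4.ofTimeSpace (t + F y) y) * p2 (E4.ofTimeSpace (t + F y) y))
      (hVp2c.comp hgraph2) (isCompact_closedBall _ _)
  have hZnn : ∀ t, 0 ≤ Zt t := fun t ↦
    setIntegral_nonneg measurableSet_closedBall fun y _ ↦ mul_nonneg (hV0 _) (hp2nn _)
  have hZi : ∀ t, IntegrableOn
      (fun y : E3 ↦ V (E4.ofTimeSpace (t + F y) y) * p2 (E4.ofTimeSpace (t + F y) y))
      (closedBall (0 : E3) (2 * ρ')) := fun t ↦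
    (hVp2c.comp (hgraph t)).continuousOn.integrableOn_compact (isCompact_closedBall _ _)
  set Z : ℝ := ∫ u in Set.Ioc 0 s, Zt u with hZ
  have hZnn' : 0 ≤ Z := setIntegral_nonneg measurableSet_Ioc fun u _ ↦ hZnn u
  have heZ : (∫ u in Set.Ioc 0 s, ∫ y in closedBall (0 : E3) (2 * ρ'),
      e (E4.ofTimeSpace (u + F y) y)) = CT * Z := by
    simp only [he, hZ, hZt, integral_const_mul]
  have herr : ENNReal.ofReal Z ≤ ENNReal.ofReal (4 * L) * ShI := by
    have h1 : ∀ u, ENNReal.ofReal (Zt u) ≤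
        ENNReal.ofReal (4 * L) * ∫⁻ y, {y : E3 | R₁ ≤ radius a (E4.ofTimeSpace (u + F y) y) ∧
          radius a (E4.ofTimeSpace (u + F y) y) ≤ R₂}.indicator (fd u) y := by
      intro u
      rw [show Zt u = ∫ y in closedBall (0 : E3) (2 * ρ'),
          V (E4.ofTimeSpace (u + F y) y) * p2 (E4.ofTimeSpace (u + F y) y) from rfl,
        ofReal_integral_eq_lintegral_ofReal (hZi u)
          (ae_of_all _ fun y ↦ mul_nonneg (hV0 _) (hp2nn _)),
        ← lintegral_const_mul' _ _ ENNReal.ofReal_ne_top]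
      calc ∫⁻ y in closedBall (0 : E3) (2 * ρ'),
            ENNReal.ofReal (V (E4.ofTimeSpace (u + F y) y) * p2 (E4.ofTimeSpace (u + F y) y))
          ≤ ∫⁻ y in closedBall (0 : E3) (2 * ρ'), ENNReal.ofReal (4 * L) *
              {y : E3 | R₁ ≤ radius a (E4.ofTimeSpace (u + F y) y) ∧
                radius a (E4.ofTimeSpace (u + F y) y) ≤ R₂}.indicator (fd u) y := by
            refine lintegral_mono fun y ↦ ?_
            by_cases hy : E4.ofTimeSpace (u + F y) y ∈ Ksh
            · have hyS : y ∈ {y : E3 | R₁ ≤ radius a (E4.ofTimeSpace (u + F y) y) ∧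
                  radius a (E4.ofTimeSpace (u + F y) y) ≤ R₂} := hy
              rw [Set.indicator_of_mem hyS, ← ENNReal.ofReal_mul (by positivity)]
              exact ENNReal.ofReal_le_ofReal (mul_le_mul_of_nonneg_right (hVle _) (hp2nn _))
            · rw [hVz _ hy, zero_mul, ENNReal.ofReal_zero]
              exact zero_le
        _ ≤ ∫⁻ y, ENNReal.ofReal (4 * L) *
              {y : E3 | R₁ ≤ radius a (E4.ofTimeSpace (u + F y) y) ∧
                radius a (E4.ofTimeSpace (u + F y) y) ≤ R₂}.indicator (fd u) y :=
            setLIntegral_le_lintegral _ _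
    calc ENNReal.ofReal Z = ∫⁻ u in Set.Ioc 0 s, ENNReal.ofReal (Zt u) :=
          ofReal_integral_eq_lintegral_ofReal
            (hZc.integrableOn_Icc.mono_set Set.Ioc_subset_Icc_self) (ae_of_all _ fun u ↦ hZnn u)
      _ ≤ ∫⁻ u in Set.Ioc 0 s, ENNReal.ofReal (4 * L) * ∫⁻ y,
            {y : E3 | R₁ ≤ radius a (E4.ofTimeSpace (u + F y) y) ∧
              radius a (E4.ofTimeSpace (u + F y) y) ≤ R₂}.indicator (fd u) y :=
          lintegral_mono fun u ↦ h1 u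
      _ = ENNReal.ofReal (4 * L) * ShI := by
          rw [hShI, lintegral_const_mul' _ _ ENNReal.ofReal_ne_top]
  -- (e) assemble
  have hq0nn : 0 ≤ ∫ y in closedBall (0 : E3) (2 * ρ'), q 0 y :=
    setIntegral_nonneg measurableSet_closedBall fun y _ ↦ hqnn 0 y
  have hCTZ : 0 ≤ CT * Z := mul_nonneg hCT0 hZnn'
  have hCc : C / c = 6 / (c * cH) * (7 / 2 + CT * (4 * L) + 1) := by
    rw [hCdef]
    field_simp
  have hr1 : 6 / (c * cH) * (7 / 2) ≤ C / c := by
    rw [hCc]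
    exact mul_le_mul_of_nonneg_left (by nlinarith [hCT0, hL0]) hk.le
  have hr2 : 6 / (c * cH) * (CT * (4 * L)) ≤ C / c := by
    rw [hCc]
    exact mul_le_mul_of_nonneg_left (by linarith) hk.le
  calc ∫⁻ y, {y : E3 | R₂ ≤ radius a (E4.ofTimeSpace (s + F y) y)}.indicator (fd s) y
      ≤ ENNReal.ofReal (6 / (c * cH)) *
          ENNReal.ofReal (∫ y in closedBall (0 : E3) (2 * ρ'), q s y) := ha
    _ ≤ ENNReal.ofReal (6 / (c * cH)) *
          ENNReal.ofReal ((∫ y in closedBall (0 : E3) (2 * ρ'), q 0 y) + CT * Z) := by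
        rw [← heZ]
        gcongr
    _ = ENNReal.ofReal (6 / (c * cH)) *
          (ENNReal.ofReal (∫ y in closedBall (0 : E3) (2 * ρ'), q 0 y) +
            ENNReal.ofReal CT * ENNReal.ofReal Z) := by
        rw [ENNReal.ofReal_add hq0nn hCTZ, ENNReal.ofReal_mul hCT0]
    _ ≤ ENNReal.ofReal (6 / (c * cH)) *
          (ENNReal.ofReal (7 / 2) * E0 + ENNReal.ofReal CT * (ENNReal.ofReal (4 * L) * ShI)) := by
        gcongr
    _ = ENNReal.ofReal (6 / (c * cH) * (7 / 2)) * E0 +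
          ENNReal.ofReal (6 / (c * cH) * (CT * (4 * L))) * ShI := by
        rw [mul_add, ← mul_assoc, ← ENNReal.ofReal_mul hk.le, ← mul_assoc, ← mul_assoc,
          ← ENNReal.ofReal_mul hk.le, ← ENNReal.ofReal_mul (mul_nonneg hk.le hCT0), mul_assoc]
    _ ≤ ENNReal.ofReal (C / c) * E0 + ENNReal.ofReal (C / c) * ShI := by
        gcongr
    _ = ENNReal.ofReal (C / c) * (E0 + ShI) := (mul_add _ _ _).symm

end Kerr

/-- **The far-region `χT` energy estimate for horizon-regular solutions through admissible leaves**
(DRSR arXiv:1402.7034, §13.2, second display, first inequality). For subextremal `(M, a)`,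
`r₀ ≤ r₊`, radii `2M < R₁ < R₂` and an admissible height function `F` there is `C < ∞` such that
every smooth `ψ : Kerr.region a r₀ → ℝ` solving `□_g ψ = 0` at the points with `r > r₊`, with data
of compact support on `{t* = F}`, satisfies for all `s ≥ 0`
`E(s; {r ≥ R₂}) ≤ C (E(0; {r ≥ R₁}) + ∫_{(0,s]} E(u; {R₁ ≤ r ≤ R₂}) du)`, `E(u; S)` the coordinate
energy through `Σ̃_u ∩ {r > r₊} = {t* = u + F}` restricted radially (`graphSliceEnergyOn`).
Proof: `Kerr.far_killingEnergy_estimate` for the representative of `ψ`.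
[cite: DafermosRodnianskiShlapentokhrothman2014, §13.2] -/
theorem kerr_horizonRegular_far_killingEnergy_estimate [Kerr.Facts] [Kerr.SliceFacts]
    {M a r₀ : ℝ} (hMa : Kerr.IsSubextremal M a) (hr : r₀ ≤ Kerr.rPlus M a) {R₁ R₂ : ℝ}
    (hR₁ : 2 * M < R₁) (hR : R₁ < R₂) {F : E3 → ℝ} (hF : Kerr.IsAdmissibleHeight M F) :
    ∃ C : ℝ≥0∞, C < ⊤ ∧ ∀ ψ : Kerr.region a r₀ → ℝ,
      ContMDiff 𝓘(ℝ, E4) 𝓘(ℝ, ℝ) ∞ ψ →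
      (∀ x : Kerr.region a r₀, Kerr.rPlus M a < Kerr.radius a (x : E4) →
        (Kerr.smoothMetric M a r₀).toPseudoRiemannianMetric.dalembertian ψ x = 0) →
      (∃ ρ : ℝ, ∀ x : Kerr.region a r₀, (x : E4) 0 = F (E4.spatial (x : E4)) →
          ρ < E4.spatialNorm (x : E4) → ψ x = 0 ∧ mfderiv 𝓘(ℝ, E4) 𝓘(ℝ, ℝ) ψ x = 0) →
      ∀ s : ℝ, 0 ≤ s →
        graphSliceEnergyOn (Kerr.exterior M a)
            (fun y : Kerr.exterior M a ↦ ψ ⟨(y : E4), Kerr.region_mono a hr y.2⟩) F s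
            {y | R₂ ≤ Kerr.radius a (E4.ofTimeSpace (s + F y) y)} ≤
        C * (graphSliceEnergyOn (Kerr.exterior M a)
              (fun y : Kerr.exterior M a ↦ ψ ⟨(y : E4), Kerr.region_mono a hr y.2⟩) F 0
              {y | R₁ ≤ Kerr.radius a (E4.ofTimeSpace (0 + F y) y)} +
            ∫⁻ u in Set.Ioc 0 s, graphSliceEnergyOn (Kerr.exterior M a)
              (fun y : Kerr.exterior M a ↦ ψ ⟨(y : E4), Kerr.region_mono a hr y.2⟩) F u
              {y | R₁ ≤ Kerr.radius a (E4.ofTimeSpace (u + F y) y) ∧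
                Kerr.radius a (E4.ofTimeSpace (u + F y) y) ≤ R₂}) := by
  obtain ⟨C, hC, h⟩ := Kerr.far_killingEnergy_estimate hMa hR₁ hR
  have hrp : 0 < Kerr.rPlus M a := hMa.rPlus_pos
  have hR₁r : Kerr.rPlus M a < R₁ := by
    have h1 : √(M ^ 2 - a ^ 2) ≤ √(M ^ 2) := Real.sqrt_le_sqrt (by nlinarith [sq_nonneg a])
    rw [Real.sqrt_sq hMa.pos.le] at h1
    unfold Kerr.rPlus
    linarith
  obtain ⟨c, hc, hc1, hslope⟩ := hF.exists_slope_le'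
  have hF2 : ContDiff ℝ 2 F := hF.contDiff.of_le (WithTop.coe_le_coe.mpr le_top)
  refine ⟨ENNReal.ofReal (C / c), ENNReal.ofReal_lt_top, fun ψ hψ hwave hdata s hs ↦ ?_⟩
  obtain ⟨ρ, hdata⟩ := hdata
  set ψ' : Kerr.exterior M a → ℝ := fun y ↦ ψ ⟨(y : E4), Kerr.region_mono a hr y.2⟩ with hψ'
  set Φ : E4 → ℝ := Function.extend Subtype.val ψ 0 with hΦ
  set Φ' : E4 → ℝ := Function.extend Subtype.val ψ' 0 with hΦ'
  have hrep : ∀ y, ψ y = Φ y := extend_rep ψ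
  have hrep' : ∀ y, ψ' y = Φ' y := extend_rep ψ'
  have hagree : ∀ z ∈ (Kerr.exterior M a : Set E4), Φ' =ᶠ[𝓝 z] Φ := by
    intro z hz
    filter_upwards [(Kerr.exterior M a).isOpen.mem_nhds hz] with w hw
    rw [← hrep' ⟨w, hw⟩, ← hrep ⟨w, Kerr.region_mono a hr hw⟩]
  have hΦ2 : ∀ z ∈ (Kerr.exterior M a : Set E4), ContDiffAt ℝ 2 Φ z := fun z hz ↦
    (contDiffAt_extend hψ ⟨z, Kerr.region_mono a hr hz⟩).of_le (WithTop.coe_le_coe.mpr le_top)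
  have hΦd : ∀ z ∈ (Kerr.exterior M a : Set E4), DifferentiableAt ℝ Φ z := fun z hz ↦
    (hΦ2 z hz).differentiableAt two_ne_zero
  have hsol : ∀ z ∈ (Kerr.exterior M a : Set E4),
      KerrSchild.waveOperator (KerrSchild.inverseMetric (fun y ↦ 2 * Kerr.scalarH M a y)
        (Kerr.nullVector a)) Φ z = 0 := by
    intro z hz
    rw [← Kerr.dalembertian_eq_waveOperator M a r₀ hrep ⟨z, Kerr.region_mono a hr hz⟩ (hΦ2 z hz)]
    exact hwave _ (Kerr.lt_radius_of_mem_region hz)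
  -- the data of the representative vanish far out on `{x⁰ = F(x⃗)}`
  have hdataΦ : ∀ y : E3, ρ < ‖y‖ → E4.ofTimeSpace (0 + F y) y ∈ Kerr.exterior M a →
      Φ (E4.ofTimeSpace (0 + F y) y) = 0 ∧ fderiv ℝ Φ (E4.ofTimeSpace (0 + F y) y) = 0 := by
    intro y hy hmem
    set z : Kerr.region a r₀ := ⟨E4.ofTimeSpace (0 + F y) y, Kerr.region_mono a hr hmem⟩ with hz
    have h := hdata z (by simp [hz, E4.ofTimeSpace_apply_zero, E4.spatial_ofTimeSpace])
      (by simpa [hz, E4.spatialNorm_ofTimeSpace] using hy)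
    refine ⟨by rw [← hrep z] at *; exact h.1, ?_⟩
    have h2 := h.2
    rwa [OpensChart.mfderiv_eq z ψ Φ hrep (hΦd _ hmem)] at h2
  -- the graph maps are continuous; the radial sets are measurable
  have hgraph : ∀ t : ℝ, Continuous fun y : E3 ↦ E4.ofTimeSpace (t + F y) y := fun t ↦
    E4.continuous_ofTimeSpace' (continuous_const.add hF2.continuous) continuous_id
  have hrc : ∀ t : ℝ, Continuous fun y : E3 ↦ Kerr.radius a (E4.ofTimeSpace (t + F y) y) :=
    fun t ↦ (Kerr.continuous_radius a).comp (hgraph t)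
  have hE : ∀ (t : ℝ) (S : Set E3), MeasurableSet S →
      graphSliceEnergyOn (Kerr.exterior M a) ψ' F t S =
        ∫⁻ y, (S ∩ {y : E3 | E4.ofTimeSpace (t + F y) y ∈ Kerr.exterior M a}).indicator
          (fun y ↦ ENNReal.ofReal
            (∑ μ, fderiv ℝ Φ (E4.ofTimeSpace (t + F y) y) (E4.basisVector μ) ^ 2)) y := by
    intro t S hS
    unfold graphSliceEnergyOn
    rw [← lintegral_indicator hS]
    refine lintegral_congr fun y ↦ ?_
    rw [Set.indicator_indicator]
    by_cases hy : y ∈ S ∩ {y : E3 | E4.ofTimeSpace (t + F y) y ∈ Kerr.exterior M a}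
    · rw [indicator_of_mem hy, indicator_of_mem hy, ← Kerr.sum_sq_fderiv_extend_eq,
        (hagree _ hy.2).fderiv_eq]
    · rw [indicator_of_notMem hy, indicator_of_notMem hy]
  have hmem : ∀ (t : ℝ) (y : E3), E4.ofTimeSpace (t + F y) y ∈ Kerr.exterior M a ↔
      Kerr.rPlus M a < Kerr.radius a (E4.ofTimeSpace (t + F y) y) := by
    intro t y
    rw [← SetLike.mem_coe]
    show E4.ofTimeSpace (t + F y) y ∈ (Kerr.exterior M a : Set E4) ↔ _
    rw [SetLike.mem_coe, Kerr.mem_exterior, max_eq_left hrp.le]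
  have h1 : ∀ (t R : ℝ), Kerr.rPlus M a < R → graphSliceEnergyOn (Kerr.exterior M a) ψ' F t
      {y | R ≤ Kerr.radius a (E4.ofTimeSpace (t + F y) y)} =
      ∫⁻ y, {y : E3 | R ≤ Kerr.radius a (E4.ofTimeSpace (t + F y) y)}.indicator
        (fun y ↦ ENNReal.ofReal
          (∑ μ, fderiv ℝ Φ (E4.ofTimeSpace (t + F y) y) (E4.basisVector μ) ^ 2)) y := by
    intro t R hRr
    have hset : {y | R ≤ Kerr.radius a (E4.ofTimeSpace (t + F y) y)} ∩
        {y : E3 | E4.ofTimeSpace (t + F y) y ∈ Kerr.exterior M a} =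
        {y : E3 | R ≤ Kerr.radius a (E4.ofTimeSpace (t + F y) y)} := by
      ext y
      simp only [Set.mem_inter_iff, Set.mem_setOf_eq, hmem]
      constructor
      · exact fun hy ↦ hy.1
      · exact fun hy ↦ ⟨hy, hRr.trans_le hy⟩
    rw [hE t _ (isClosed_le continuous_const (hrc t)).measurableSet, hset]
  have h2 : ∀ (t R R' : ℝ), Kerr.rPlus M a < R → graphSliceEnergyOn (Kerr.exterior M a) ψ' F t
      {y | R ≤ Kerr.radius a (E4.ofTimeSpace (t + F y) y) ∧
        Kerr.radius a (E4.ofTimeSpace (t + F y) y) ≤ R'} =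
      ∫⁻ y, {y : E3 | R ≤ Kerr.radius a (E4.ofTimeSpace (t + F y) y) ∧
          Kerr.radius a (E4.ofTimeSpace (t + F y) y) ≤ R'}.indicator
        (fun y ↦ ENNReal.ofReal
          (∑ μ, fderiv ℝ Φ (E4.ofTimeSpace (t + F y) y) (E4.basisVector μ) ^ 2)) y := by
    intro t R R' hRr
    have hm : MeasurableSet {y : E3 | R ≤ Kerr.radius a (E4.ofTimeSpace (t + F y) y) ∧
        Kerr.radius a (E4.ofTimeSpace (t + F y) y) ≤ R'} := by
      rw [Set.setOf_and]
      exact ((isClosed_le continuous_const (hrc t)).inter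
        (isClosed_le (hrc t) continuous_const)).measurableSet
    have hset : {y | R ≤ Kerr.radius a (E4.ofTimeSpace (t + F y) y) ∧
        Kerr.radius a (E4.ofTimeSpace (t + F y) y) ≤ R'} ∩
        {y : E3 | E4.ofTimeSpace (t + F y) y ∈ Kerr.exterior M a} =
        {y : E3 | R ≤ Kerr.radius a (E4.ofTimeSpace (t + F y) y) ∧
          Kerr.radius a (E4.ofTimeSpace (t + F y) y) ≤ R'} := by
      ext y
      simp only [Set.mem_inter_iff, Set.mem_setOf_eq, hmem]
      constructor
      · exact fun hy ↦ hy.1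
      · exact fun hy ↦ ⟨hy, hRr.trans_le hy.1⟩
    rw [hE t _ hm, hset]
  rw [h1 s R₂ (hR₁r.trans hR), h1 0 R₁ hR₁r, lintegral_congr (fun u ↦ h2 u R₁ R₂ hR₁r)]
  exact h F c hF2 hc hc1 hslope Φ hΦ2 hsol ρ hdataΦ s hs

end Literature.Geometry.Lorentzian
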